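import Summits.QuantumFields.BalabanUV.T4Continuum.Support.NE7SliceIterationState
import Summits.QuantumFields.BalabanUV.T4Continuum.Support.NE7AccumulatedFrameLinearisation
import HarnessLib

/-!
# NE7SliceIterationStateNL — THE STATE OF THE (S1) ITERATION ON THE NONLINEAR FRAME TARGET (memo ROAD-G103 §3, (R1′), file (B2)-1): the old state maps of `NE7SliceIterationState` with the
# corner logs `h(u)` replaced, in the datum and the mismatch, by the EFFECTIVE corner logs `h̃(u) := h(u) − P(u)`, `P(u) := mlog v_{k+1}(X(u)) − framePotW X(u)` (the nonlinear-minus-linear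
# accumulated frame of the chart field): `φ̃(u) = dirIter X(u) − gaugeDir_V h̃(u)` (= `φ(u) + gaugeDir_V P(u)`), `Ñ(u) = rightInvW φ̃(u)`, `T̃(u) = X(u) − Ñ(u)`, the split of `(T̃(u), h̃(u))`,
# `m̃(u) = sup‖framePotW T̃(u) − h̃(u)‖` (= `sup‖mlog v_{k+1}(X(u)) − framePotW Ñ(u) − h(u)‖`), `D̃f(u) = δ̃(u) + m̃(u)∕M`, the step `u ↦ e^{−ζ̃(u)}·u`

Cell `pub-balaban`, rung (B)+1 sub-cell t4, lineage `b2b-balaban-t4-ne7-p1`, generation 103 (CRUX PROVER NE7 #1 = OWNER of BINDER row NE7).  Memo `t4/b2b-balaban-t4-ne7-p1-g103/ROAD-G103.md` §1–§3.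
WHY.  At the fixed point of the old iteration the LINEAR frames are matched (`framePotW T(u⋆) = h(u⋆)`, NE7b p768804) and the coarse datum `φ(u⋆)` carries `−gaugeDir_V P(X⋆)`, whose cross-level
corner-charge polygon grows like `k` per unit energy in the flat slice model (FINDING-1, kit j340362∕j340363).  At the fixed point of THIS iteration `mlog v_{k+1}(X⋆) = h⋆ + framePotW Ñ⋆` ((1.37) up
to the N-frame) and `φ̃⋆ = −Rem_dbar(X⋆) +` absorbable — [Balaban1985Averaging] (92)∕(97)'s own normalisation.  The one-step identities of `NE7SliceStepIdentities` transfer VERBATIM under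
`h ↦ h̃`, with corner junk `j_c + (P(X⁰) − P(X¹))` (sized by `NE7FrameDefectLipschitz`, (LP)).  THIS FILE only DEFINES the new state maps and proves their elementary access lemmas, exactly as
`NE7SliceIterationState` did for the old ones (whose `siteSup`∕`bondSup`∕`repLog`∕`cornerLog`∕`IsNormalisedSplit`∕`sizePair` are REUSED BY NAME).
WHAT ([folklore]; 10 def, 0 sorry).  `frameDefect` (`P(u)`), `effCornerLog` (`h̃(u)`), `coarseDatumNL` (`φ̃(u)`), `coarseDatumNL_eq` (`φ̃ = φ + gaugeDir_V P`), `normalPartNL`, `normalPartNL_eq`,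
`tangentPartNL`, `gaugeFunNL`, `slicePartNL`, `splitNL_spec`, `frameMismatchNL`, `sliceDefectNL`, `sliceStepNL`, `sliceDefectNL_nonneg`, `effCornerLog_add_frameDefect`.
HONEST FRAMING (page 1): definitions and bookkeeping; NO estimate; nothing of Bałaban's asserted; NOT the re-issued (S1), NOT NE7; spine 0∕9; finite T⁴ rung (B)+1 — NOT infinite volume, NOT mass gap,
NOT BetaPertH, NOT Clay.  Continuum YM on T⁴ ⇐ BetaPertH ∧ nine spine estimates (0/9 proved); BetaPertH ⇐ (D1) ∧ (D4) ∧ CAP+tail; G-an2-4 gates asym, D1 and NE2/3/4.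
-/

set_option autoImplicit false

open scoped BigOperators Matrix.Norms.L2Operator
open Finset

namespace Summit.QuantumFields.BalabanUV.T4Continuum.NE7SliceIterationStateNL

open Literature.MathematicalPhysics.QuantumFieldTheory.Balaban1983to89
open B7Prop1Explicit B7Prop2Explicit MatrixLog
open B7Eq92Concrete (vcov)
open T4AveragingDeficitWall (IsUnitaryCfg IsSkewDir SmallField)
open T4AveragingDeficitWallBoundary (periodBox)
open AveragingDeficitMultiLevelPrep (cavgIter LevelSmall tower)
open BlockAveragePushDirGauge (gaugeDir)
open NE3TangentCovariantTower (dirIter framePotW)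
open NE3TangentCovariantStructure (gaugeDir_add_fun)
open NE3QbarIterCovLiftPrep (cruxC)
open NE3SmoothRightInverseW (rightInvW)
open NE3.PairLandauB8Avg (relPert)
open NE7SliceIterationState (siteSup siteSup_nonneg bondSup bondSup_nonneg repLog cornerLog coarseDatum IsNormalisedSplit)

noncomputable section

variable {d : ℕ} {n : Type*} [Fintype n] [DecidableEq n]

/-! ## §1 The nonlinear frame defect of the chart field and the effective corner logs -/

/-- **`P(u)`**: the nonlinear-minus-linear accumulated frame of the chart field, `P(u)(z) := mlog v_{k+1}(X(u))(z) − framePotW L (k+1) W X(u) z`, `v_{k+1} = vcov L W (relPert W X(u)) (k+1)`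
([Balaban1985Averaging] (97)); second order, k-free (`NE7AccumulatedFrameLinearisation`). [folklore] -/
def frameDefect [Nonempty n] (L k : ℕ) (W U' : Site d → Fin d → (Matrix n n ℂ)ˣ) (u : Site d → (Matrix n n ℂ)ˣ) : Site d → Matrix n n ℂ :=
  fun z => mlog ((vcov L W (relPert W (repLog W U' u)) (k + 1) z : (Matrix n n ℂ)ˣ) : Matrix n n ℂ) - framePotW L (k + 1) W (repLog W U' u) z

/-- **`h̃(u)`**: the EFFECTIVE corner logs `h̃(u) := h(u) − P(u)`. [folklore] -/
def effCornerLog [Nonempty n] (L k : ℕ) (W U' : Site d → Fin d → (Matrix n n ℂ)ˣ) (u : Site d → (Matrix n n ℂ)ˣ) : Site d → Matrix n n ℂ :=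
  fun z => cornerLog L k u z - frameDefect L k W U' u z

/-- `h̃(u) + P(u) = h(u)`. [folklore] -/
theorem effCornerLog_add_frameDefect [Nonempty n] (L k : ℕ) (W U' : Site d → Fin d → (Matrix n n ℂ)ˣ) (u : Site d → (Matrix n n ℂ)ˣ) (z : Site d) :
    effCornerLog L k W U' u z + frameDefect L k W U' u z = cornerLog L k u z := by
  rw [effCornerLog, sub_add_cancel]

/-- **`φ̃(u)`**: the coarse datum on the nonlinear target, `φ̃(u) := dirIter X(u) − gaugeDir_V h̃(u)`, `V = cavgIter L (k+1) W`. [folklore] -/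
def coarseDatumNL [Nonempty n] (L k : ℕ) (W U' : Site d → Fin d → (Matrix n n ℂ)ˣ) (u : Site d → (Matrix n n ℂ)ˣ) : Site d → Fin d → Matrix n n ℂ :=
  fun z κ => dirIter L (k + 1) W (repLog W U' u) z κ - gaugeDir (cavgIter L (k + 1) W) (effCornerLog L k W U' u) z κ

/-- **`φ̃ = φ + gaugeDir_V P`**: the new datum is the old one plus the coarse gauge direction of the frame defect. [folklore] -/
theorem coarseDatumNL_eq [Nonempty n] (L k : ℕ) (W U' : Site d → Fin d → (Matrix n n ℂ)ˣ) (u : Site d → (Matrix n n ℂ)ˣ) (z : Site d) (κ : Fin d) :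
    coarseDatumNL L k W U' u z κ = coarseDatum L k W U' u z κ + gaugeDir (cavgIter L (k + 1) W) (frameDefect L k W U' u) z κ := by
  have e : cornerLog L k u = fun x => effCornerLog L k W U' u x + frameDefect L k W U' u x :=
    funext fun x => (effCornerLog_add_frameDefect L k W U' u x).symm
  simp only [coarseDatumNL, coarseDatum]
  rw [e, gaugeDir_add_fun]
  abel

/-! ## §2 The state maps on the nonlinear target -/

section State

variable [Nonempty n] {L : ℕ} (hL : 2 ≤ L) (k : ℕ) {W : Site d → Fin d → (Matrix n n ℂ)ˣ} {x : ℝ} (hWu : IsUnitaryCfg W) (hx : 0 ≤ x) (hs : LevelSmall d L k x)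
  (hWx : SmallField W x) (N : ℕ) [NeZero N] (hθ : cruxC d L * (((L : ℝ) ^ (k + 1)) ^ 2 * x) < 1) (U' : Site d → Fin d → (Matrix n n ℂ)ˣ)

open Classical in
/-- **`Ñ(u)`**: the normal part `rightInvW φ̃(u)` (defined when `φ̃(u)` is skew — true on the working region —, else `0`). [folklore] -/
def normalPartNL (u : Site d → (Matrix n n ℂ)ˣ) : Site d → Fin d → Matrix n n ℂ :=
  if hφ : IsSkewDir (coarseDatumNL L k W U' u) then rightInvW hL k hWu hx hs hWx N hθ hφ else fun _ _ => 0

/-- on the working region `Ñ(u) = rightInvW φ̃(u)` (any skewness witness). [folklore] -/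
theorem normalPartNL_eq {u : Site d → (Matrix n n ℂ)ˣ} (hφ : IsSkewDir (coarseDatumNL L k W U' u)) :
    normalPartNL hL k hWu hx hs hWx N hθ U' u = rightInvW hL k hWu hx hs hWx N hθ hφ := by
  rw [normalPartNL, dif_pos hφ]

/-- **`T̃(u)`**: the tangent part `X(u) − Ñ(u)` (so `dirIter T̃(u) = gaugeDir_V h̃(u)` on the working region, `dirIter_rightInvW`). [folklore] -/
def tangentPartNL (u : Site d → (Matrix n n ℂ)ˣ) : Site d → Fin d → Matrix n n ℂ :=
  fun y κ => repLog W U' u y κ - normalPartNL hL k hWu hx hs hWx N hθ U' u y κ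

open Classical in
/-- **`ζ̃(u)`**: the gauge function of a CHOSEN normalised split of `(T̃(u), h̃(u))` (`0` if none exists; its `gaugeDir W ζ̃(u)` is canonical, `NE7SliceSplitUnique.slice_split_unique`). [folklore] -/
def gaugeFunNL (u : Site d → (Matrix n n ℂ)ˣ) : Site d → Matrix n n ℂ :=
  if h : ∃ p : (Site d → Matrix n n ℂ) × (Site d → Fin d → Matrix n n ℂ),
      IsNormalisedSplit L k N W (tangentPartNL hL k hWu hx hs hWx N hθ U' u) (effCornerLog L k W U' u) p.1 p.2 then (Classical.choose h).1
  else fun _ => 0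

open Classical in
/-- **`Ỹ(u)`** on the nonlinear target: the slice part of the chosen normalised split (`T̃(u)` itself if none exists). [folklore] -/
def slicePartNL (u : Site d → (Matrix n n ℂ)ˣ) : Site d → Fin d → Matrix n n ℂ :=
  if h : ∃ p : (Site d → Matrix n n ℂ) × (Site d → Fin d → Matrix n n ℂ),
      IsNormalisedSplit L k N W (tangentPartNL hL k hWu hx hs hWx N hθ U' u) (effCornerLog L k W U' u) p.1 p.2 then (Classical.choose h).2
  else tangentPartNL hL k hWu hx hs hWx N hθ U' u

/-- the chosen pair IS a normalised split of `(T̃(u), h̃(u))` whenever one exists. [folklore] -/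
theorem splitNL_spec {u : Site d → (Matrix n n ℂ)ˣ}
    (h : ∃ p : (Site d → Matrix n n ℂ) × (Site d → Fin d → Matrix n n ℂ),
      IsNormalisedSplit L k N W (tangentPartNL hL k hWu hx hs hWx N hθ U' u) (effCornerLog L k W U' u) p.1 p.2) :
    IsNormalisedSplit L k N W (tangentPartNL hL k hWu hx hs hWx N hθ U' u) (effCornerLog L k W U' u)
      (gaugeFunNL hL k hWu hx hs hWx N hθ U' u) (slicePartNL hL k hWu hx hs hWx N hθ U' u) := by
  rw [gaugeFunNL, slicePartNL, dif_pos h, dif_pos h]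
  exact Classical.choose_spec h

/-- **`m̃(u)`**: the frame mismatch on the nonlinear target, `sup_z ‖framePotW T̃(u) z − h̃(u) z‖` (box sup over the coarse period `N`); since `h̃ = h − P` and `framePotW T̃ = framePotW X − framePotW Ñ`
in the class, this is `sup_z ‖mlog v_{k+1}(X(u))(z) − framePotW Ñ(u) z − h(u) z‖` — the (1.37)-defect up to the N-frame. [folklore] -/
def frameMismatchNL (u : Site d → (Matrix n n ℂ)ˣ) : ℝ :=
  siteSup N fun z => ‖framePotW L (k + 1) W (tangentPartNL hL k hWu hx hs hWx N hθ U' u) z - effCornerLog L k W U' u z‖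

/-- **`D̃f(u)`**: the defect `δ̃(u) + m̃(u)∕M`, `δ̃(u) := sup‖gaugeDir W ζ̃(u)‖` (box sup over the fine period), `M = L^{k+1}`. [folklore] -/
def sliceDefectNL (u : Site d → (Matrix n n ℂ)ˣ) : ℝ :=
  bondSup (tower L N (k + 1)) (fun y μ => ‖gaugeDir W (gaugeFunNL hL k hWu hx hs hWx N hθ U' u) y μ‖)
    + frameMismatchNL hL k hWu hx hs hWx N hθ U' u / (L : ℝ) ^ (k + 1)

/-- **THE STEP** `u ↦ e^{−ζ̃(u)}·u`. [folklore] -/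
def sliceStepNL (u : Site d → (Matrix n n ℂ)ˣ) : Site d → (Matrix n n ℂ)ˣ :=
  (fun y => expUnit (-gaugeFunNL hL k hWu hx hs hWx N hθ U' u y)) * u

/-- the defect is nonnegative (`L ≥ 2`). [folklore] -/
theorem sliceDefectNL_nonneg (u : Site d → (Matrix n n ℂ)ˣ) : 0 ≤ sliceDefectNL hL k hWu hx hs hWx N hθ U' u := by
  have hM : 0 < (L : ℝ) ^ (k + 1) := pow_pos (by exact_mod_cast (by omega : 0 < L)) _
  exact add_nonneg (bondSup_nonneg fun y μ => norm_nonneg _) (div_nonneg (siteSup_nonneg fun z => norm_nonneg _) hM.le)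

/-- `sliceStepNL u y = e^{−ζ̃(u)(y)}·u(y)`. [folklore] -/
theorem sliceStepNL_apply (u : Site d → (Matrix n n ℂ)ˣ) (y : Site d) :
    sliceStepNL hL k hWu hx hs hWx N hθ U' u y = expUnit (-gaugeFunNL hL k hWu hx hs hWx N hθ U' u y) * u y := rfl

end State

end

end Summit.QuantumFields.BalabanUV.T4Continuum.NE7SliceIterationStateNL
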